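/-
Copyright (c) 2026 the pub-hodgecm-mathlib formalisation cell (harness21).  Prover seat hodgecm-mathlib-K2E5-p03 (g2),
Track B «K2-LIT» ∕ h413 (stmt-HodgeConjecture-24833), line K2_E5 «TamagawaUnitary», DEFS LEAF #3j-bis (K2E5-plan (g0) DEALS E5 BATCH #7 (b),
2026-09-03T22:54:44Z — the part of (b) not already ★ in #3j `K2E5QuatAdelicLatticeDefs`): the module-one group BY NAME over ★ #3g `quatModule`,
the CENTRAL SECTION of the module and its surjectivity.
2026-09-03.
-/
import Summits.HodgeConjecture.HodgeConjecture.Theorems.K2E5QuatAdelicLatticeDefs   -- ★ #3j (K2E5-p03, p855463): `quatAdelicUnitsOne`, `quatRatLattice`, product formula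
import Summits.HodgeConjecture.HodgeConjecture.Theorems.K2E5QuatZetaDefs            -- ★ #3g (K2E5-p16, p855316): `quatModule`, `quatModule_apply`, `continuous_quatModule`
import Literature.NumberTheory.AdelicBaseChange.IdeleNormModule                      -- ★ `ideleNorm_ideleBaseChange` (‖con x‖_L = ‖x‖_K^{[L:K]})
import HarnessLib

/-!
# K2 ∕ E5 «TamagawaUnitary» — DEFS LEAF #3j-bis `K2E5QuatAdelicModuleOneDefs`: `D^{(1)}_{h,𝔸} = ker quatModule` BY NAME, the central section
# `θ : ℝ_{>0} →* (D_h ⊗ 𝔸)^×` of the module (`quatModule (θ t) = t`), and the surjectivity of the module onto `ℝ_{>0}`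

Cell `hodgecm-mathlib` (Track B «K2-LIT»), engine E5, item h413 = `stmt-HodgeConjecture-24833` (`--kind definition --supports … --as helper`);
dealt BY NAME by K2E5-plan (g0), DEALS E5 BATCH #7 (b) (2026-09-03T22:54:44Z) to base K2E5-p03 (g2).  (b) asked for (i) `quatAdelicUnitsOne :=
{x | quatModule x = 1}`, (ii) the rational units read inside `(D_h ⊗ 𝔸)^×` with discreteness ∕ closedness ∕ countability and the PRODUCT FORMULA, (iii) a
continuous section `θ : ℝ_{>0} → (D_h ⊗ 𝔸)^×` of the module, (iv) surjectivity of the module.  (ii) and the object of (i) are ★ #3j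
`K2E5QuatAdelicLatticeDefs` (p855463, which crossed BATCH #7 on the bus: `quatRatLattice`, `quatAdelicUnitsOne := (normOneIdeles L).comap quatAdelicNrd`,
`quatRatLattice_le_quatAdelicUnitsOne`); THIS file supplies the BY-NAME bridge of (i) to ★ #3g `K2E5QuatZeta.quatModule` (ONE object, two spellings,
`Iff.rfl` on members), (iii) and (iv).  DEFINITIONS WITH BODIES + lemmas; no `sorry`, axioms ⊆ the trio, no `instance`, no `notation`, no binder-less
`def … : Prop`.

THE OBJECTS ([VignerasLNM800, Ch. III §1 (module `‖x‖_A`, `X_{A,1}`), Ch. III §2 (proof of Thm. 2.2: `X_A^× = X_{A,1} × ℝ_{>0}` through a central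
section, Fujisaki)]; [WeilBNT1967, Ch. IV §4 (the split component of `k_A^×`, Cor. 2 of Thm. 5)]; [Borel1963, §5 (`A_G` for `GL_n`)]).
* §1 **BRIDGE**: `quatModule_eq_ideleNorm_quatAdelicNrd` (`quatModule x = ‖Nrd x‖_{𝔸_L}`, `rfl`), `mem_quatAdelicUnitsOne_iff_quatModule`
  (`x ∈ D^{(1)} ↔ quatModule x = 1`), **`quatAdelicUnitsOne_eq_ker_quatModule : quatAdelicUnitsOne L h = (quatModule L h).ker`**, the units-valued module
  `quatModuleUnits := (quatModule L h).toHomUnits : (D_h ⊗ 𝔸)^× →* ℝ≥0ˣ` (★ `ideleNormUnits` pattern) with `quatAdelicUnitsOne_eq_ker_quatModuleUnits`,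
  `continuous_quatModuleUnits`.
* §2 **THE CENTRAL SCALARS**: `baseScalar L h : 𝕀_{L⁺} →* (D_h ⊗ 𝔸)^×`, `y ↦ con(y) · 1₂` — the base-changed idèle (★ `AdeleRing.ideleBaseChange L⁺ L`) is
  `c ⊗ 1`-fixed (★ #3i `fixedAdelicUnits_eq_range_ideleBaseChange`), hence its scalar matrix lies in the model (★ #3d `smul_mem_quatAdelic`); Mathlib
  `Matrix.GeneralLinearGroup.scalar`.  Central (`baseScalar_mul_comm`), continuous, `Nrd (baseScalar y) = con(y)²` (`quatAdelicNrd_baseScalar`), and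
  **`quatModule (baseScalar y) = ‖y‖_{L⁺}^4`** (`quatModule_baseScalar`: Mathlib `det_scalar`, ★ `ideleNorm_ideleBaseChange`, `[L : L⁺] = 2`).
* §3 **THE SECTION `θ = quatModuleSection L h : ℝ≥0ˣ →* (D_h ⊗ 𝔸)^×`**, `t ↦ baseScalar (ρ_{L⁺}(t^{1∕4d}))` with `d = [L⁺ : ℚ]` and `ρ` the positive-real idèle
  ★ `posRealIdele` (`‖ρ(r)‖ = r^d`, ★ `ideleNormUnits_posRealIdele`): **`quatModuleUnits_quatModuleSection : quatModuleUnits (θ t) = t`**,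
  `quatModule_quatModuleSection`, `continuous_quatModuleSection` (★ `continuous_posRealIdele`, ★ `AdeleRing.continuous_baseChange`, Mathlib
  `NNReal.continuous_rpow_const`), centrality `quatModuleSection_mul_comm`; consequences **`quatModuleUnits_surjective`**, `exists_quatModule_eq`
  (every `t > 0` is a module), and the RETRACTION onto `D^{(1)}`: `mul_quatModuleSection_inv_mem_quatAdelicUnitsOne` (`x · θ(‖x‖)⁻¹ ∈ D^{(1)}_{h,𝔸}`) —
  the splitting `(D_h ⊗ 𝔸)^× = D^{(1)}_{h,𝔸} · θ(ℝ_{>0})` used by Tate's unfolding (G3) and by the `D^{(1)}`-restriction of the open reduced norm (G5).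

HONEST LABEL: HC_CM is proved only modulo the 7 printed citations (2 remaining named inputs: hLiu418 = stmt-HodgeConjecture-24832,
h413 = stmt-HodgeConjecture-24833) until rung 0 closes; this file NAMES the module-one data and asserts nothing toward any count.

## References
* [VignerasLNM800] M.-F. Vignéras, *Arithmétique des algèbres de quaternions*, LNM 800 (1980), Ch. III §1, §2 (proof of Thm. 2.2).
* [WeilBNT1967] A. Weil, *Basic Number Theory* (1967), Ch. IV §4 (Cor. 2 of Thm. 5; the module and `k_{A,1}`).
* [Borel1963] A. Borel, *Some finiteness properties of adele groups over number fields*, Publ. Math. IHÉS 16 (1963), §5.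
-/

set_option autoImplicit false
-- the mandated namespace repeats the single-problem summit's segment (`HodgeConjecture.HodgeConjecture`)
set_option linter.dupNamespace false

noncomputable section

namespace Summit.HodgeConjecture.HodgeConjecture.Cruxes.H413.K2E5QuatAdelicModuleOne

open NumberField IsDedekindDomain
open Literature.NumberTheory.Automorphic
open Summit.HodgeConjecture.HodgeConjecture.Cruxes.H413.K2E5QuatAdelicMatrixModel
open Summit.HodgeConjecture.HodgeConjecture.Cruxes.H413.K2E5QuatAdelicNrd
open Summit.HodgeConjecture.HodgeConjecture.Cruxes.H413.K2E5QuatAdelicLattice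
open Summit.HodgeConjecture.HodgeConjecture.Cruxes.H413.K2E5QuatZeta
open scoped Matrix MatrixGroups NNReal

variable (L : Type) [Field L] [NumberField L] [IsCMField L] (Ha : Matrix (Fin 2) (Fin 2) L)

/-! ## §1 `D^{(1)}_{h,𝔸} = ker quatModule` by name -/

/-- `quatModule x = ‖Nrd x‖_{𝔸_L}`: ★ #3g `quatModule` and ★ #3i `quatAdelicNrd` followed by ★ `IdeleClassGroup.ideleNorm` are the same function
(both `rfl` onto `ideleNorm (det x)`). [cite: VignerasLNM800, Ch. III §1 (module)] -/
theorem quatModule_eq_ideleNorm_quatAdelicNrd (x : ↥(quatAdelicUnits L Ha)) :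
    quatModule L Ha x = IdeleClassGroup.ideleNorm L (quatAdelicNrd L Ha x) := rfl

/-- `x ∈ D^{(1)}_{h,𝔸} ↔ quatModule x = 1` (★ #3j `mem_quatAdelicUnitsOne_iff` in the ★ #3g spelling). [cite: VignerasLNM800, Ch. III §1 (X_{A,1})] -/
theorem mem_quatAdelicUnitsOne_iff_quatModule (x : ↥(quatAdelicUnits L Ha)) :
    x ∈ quatAdelicUnitsOne L Ha ↔ quatModule L Ha x = 1 :=
  mem_quatAdelicUnitsOne_iff L Ha x

/-- **`D^{(1)}_{h,𝔸} = ker quatModule`** — the dealer's spelling of BATCH #7 (b) and ★ #3j's `quatAdelicUnitsOne` are ONE subgroup. [cite: VignerasLNM800, Ch. III §1 (X_{A,1})] -/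
theorem quatAdelicUnitsOne_eq_ker_quatModule : quatAdelicUnitsOne L Ha = (quatModule L Ha).ker :=
  Subgroup.ext fun x => mem_quatAdelicUnitsOne_iff_quatModule L Ha x

/-- The module with values in the group `ℝ_{>0} = ℝ≥0ˣ` (Mathlib `MonoidHom.toHomUnits`; the ★ `ideleNormUnits` pattern). [cite: WeilBNT1967, Ch. IV §4] -/
def quatModuleUnits : ↥(quatAdelicUnits L Ha) →* ℝ≥0ˣ :=
  (quatModule L Ha).toHomUnits

/-- `quatModuleUnits` is `quatModule` (definitional). [folklore] -/
@[simp] theorem coe_quatModuleUnits (x : ↥(quatAdelicUnits L Ha)) : (quatModuleUnits L Ha x : ℝ≥0) = quatModule L Ha x := rfl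

/-- `D^{(1)}_{h,𝔸} = ker quatModuleUnits`. [cite: VignerasLNM800, Ch. III §1 (X_{A,1})] -/
theorem quatAdelicUnitsOne_eq_ker_quatModuleUnits : quatAdelicUnitsOne L Ha = (quatModuleUnits L Ha).ker := by
  ext x
  rw [mem_quatAdelicUnitsOne_iff_quatModule, MonoidHom.mem_ker, ← coe_quatModuleUnits, Units.val_eq_one]

/-- `quatModuleUnits` is continuous (units topology; ★ `continuous_quatModule` and continuity of inversion on `ℝ≥0` away from `0`). [folklore] -/
theorem continuous_quatModuleUnits : Continuous (quatModuleUnits L Ha) := by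
  have hc : Continuous fun x : ↥(quatAdelicUnits L Ha) => (quatModule L Ha x : ℝ≥0) :=
    continuous_real_toNNReal.comp (continuous_quatModule L Ha) |>.congr fun x => by simp
  refine Units.continuous_iff.2 ⟨hc, ?_⟩
  have hne : ∀ x : ↥(quatAdelicUnits L Ha), (quatModule L Ha x : ℝ≥0) ≠ 0 := fun x =>
    (quatModuleUnits L Ha x).ne_zero
  exact (hc.inv₀ hne).congr fun x => by simp [quatModuleUnits]

/-! ## §2 The central scalars `con(y) · 1₂`, `y ∈ 𝕀_{L⁺}` -/

/-- The base change `con(y) ∈ 𝕀_L` of an idèle `y` of `L⁺` is `c ⊗ 1`-fixed (★ #3i `fixedAdelicUnits_eq_range_ideleBaseChange`). [cite: CasselsFrohlichANT1967, Ch. II §14] -/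
theorem adeleConj_ideleBaseChange (y : (AdeleRing (𝓞 ↥(maximalRealSubfield L)) ↥(maximalRealSubfield L))ˣ) :
    adeleConj L ((AdeleRing.ideleBaseChange (↥(maximalRealSubfield L)) L y : (AdeleRing (𝓞 L) L)ˣ) : AdeleRing (𝓞 L) L) =
      (AdeleRing.ideleBaseChange (↥(maximalRealSubfield L)) L y : (AdeleRing (𝓞 L) L)ˣ) := by
  have h : AdeleRing.ideleBaseChange (↥(maximalRealSubfield L)) L y ∈ fixedAdelicUnits L := by
    rw [fixedAdelicUnits_eq_range_ideleBaseChange]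
    exact ⟨y, rfl⟩
  exact (mem_fixedAdelicUnits_iff L _).1 h

/-- The scalar matrix of a `c ⊗ 1`-fixed idèle lies in `(D_h ⊗ 𝔸)^×` (★ #3d `smul_mem_quatAdelic`: `D_{h,𝔸}` is an `𝔸_{L⁺}`-module containing `1`).
[cite: VignerasLNM800, Ch. III §1 (X_A ⊃ K_A)] -/
theorem scalar_mem_quatAdelicUnits {a : (AdeleRing (𝓞 L) L)ˣ} (ha : adeleConj L (a : AdeleRing (𝓞 L) L) = a) :
    Matrix.GeneralLinearGroup.scalar (Fin 2) a ∈ quatAdelicUnits L Ha := by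
  rw [mem_quatAdelicUnits_iff, Matrix.GeneralLinearGroup.coe_scalar, Matrix.scalar_apply, ← Matrix.smul_one_eq_diagonal]
  exact smul_mem_quatAdelic L Ha ha (Subring.one_mem _)

/-- **`baseScalar L h : 𝕀_{L⁺} →* (D_h ⊗ 𝔸)^×`, `y ↦ con(y) · 1₂`** — the centre `K_A^× ⊂ X_A^×` of the adelic quaternion units in the model.
[cite: VignerasLNM800, Ch. III §1 (K_A^× ⊂ X_A^×)] [cite: Borel1963, §5] -/
def baseScalar : (AdeleRing (𝓞 ↥(maximalRealSubfield L)) ↥(maximalRealSubfield L))ˣ →* ↥(quatAdelicUnits L Ha) :=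
  ((Matrix.GeneralLinearGroup.scalar (Fin 2)).comp (AdeleRing.ideleBaseChange (↥(maximalRealSubfield L)) L)).codRestrict
    (quatAdelicUnits L Ha) fun y => scalar_mem_quatAdelicUnits L Ha (adeleConj_ideleBaseChange L y)

/-- `baseScalar y = con(y) · 1₂` in `GL₂(𝔸_L)`. [folklore] -/
@[simp] theorem coe_baseScalar (y : (AdeleRing (𝓞 ↥(maximalRealSubfield L)) ↥(maximalRealSubfield L))ˣ) :
    ((baseScalar L Ha y : ↥(quatAdelicUnits L Ha)) : GL (Fin 2) (AdeleRing (𝓞 L) L)) =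
      Matrix.GeneralLinearGroup.scalar (Fin 2) (AdeleRing.ideleBaseChange (↥(maximalRealSubfield L)) L y) := rfl

/-- The scalars are CENTRAL in `(D_h ⊗ 𝔸)^×` (Mathlib `Matrix.GeneralLinearGroup.scalar_commute`). [cite: VignerasLNM800, Ch. III §1] -/
theorem baseScalar_mul_comm (y : (AdeleRing (𝓞 ↥(maximalRealSubfield L)) ↥(maximalRealSubfield L))ˣ) (x : ↥(quatAdelicUnits L Ha)) :
    baseScalar L Ha y * x = x * baseScalar L Ha y :=
  Subtype.ext (Matrix.GeneralLinearGroup.scalar_commute _ _)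

/-- `baseScalar` is continuous (★ `AdeleRing.continuous_baseChange` on units; the scalar embedding `𝕀_L → GL₂(𝔸_L)` is `Units.map` of the continuous
ring map `a ↦ a · 1₂`). [folklore] -/
theorem continuous_baseScalar : Continuous (baseScalar L Ha) := by
  have h1 : Continuous (AdeleRing.ideleBaseChange (↥(maximalRealSubfield L)) L) :=
    Continuous.units_map _ (AdeleRing.continuous_baseChange (↥(maximalRealSubfield L)) L)
  have hs : Continuous fun a : AdeleRing (𝓞 L) L => Matrix.scalar (Fin 2) a := by
    have e : (fun a : AdeleRing (𝓞 L) L => Matrix.scalar (Fin 2) a) = fun a => Matrix.diagonal fun _ : Fin 2 => a :=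
      funext fun a => Matrix.scalar_apply a
    rw [e]
    exact (continuous_pi fun _ => continuous_id).matrix_diagonal
  have h2 : Continuous (Matrix.GeneralLinearGroup.scalar (Fin 2) : (AdeleRing (𝓞 L) L)ˣ →* GL (Fin 2) (AdeleRing (𝓞 L) L)) :=
    Continuous.units_map ((Matrix.scalar (Fin 2) : AdeleRing (𝓞 L) L →+* Matrix (Fin 2) (Fin 2) (AdeleRing (𝓞 L) L)).toMonoidHom) hs
  exact (h2.comp h1).subtype_mk _

/-- **`Nrd (con(y) · 1₂) = con(y)²`** (Mathlib `Matrix.GeneralLinearGroup.det_scalar`). [cite: VignerasLNM800, Ch. I §1 (n(x) = x x̄; n|_K = squaring)] -/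
theorem quatAdelicNrd_baseScalar (y : (AdeleRing (𝓞 ↥(maximalRealSubfield L)) ↥(maximalRealSubfield L))ˣ) :
    quatAdelicNrd L Ha (baseScalar L Ha y) = AdeleRing.ideleBaseChange (↥(maximalRealSubfield L)) L y ^ 2 := by
  rw [quatAdelicNrd_apply, coe_baseScalar, Matrix.GeneralLinearGroup.det_scalar, Fintype.card_fin]

/-- **`quatModule (con(y) · 1₂) = ‖y‖_{L⁺}^4`**: `‖con(y)²‖_L = ‖con y‖_L² = (‖y‖_{L⁺}^{[L:L⁺]})² = ‖y‖_{L⁺}^4` (★ `ideleNorm_ideleBaseChange`, `[L : L⁺] = 2`).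
[cite: WeilBNT1967, Ch. IV §3 Cor. of Prop. 3; Ch. IV §4] -/
theorem quatModule_baseScalar (y : (AdeleRing (𝓞 ↥(maximalRealSubfield L)) ↥(maximalRealSubfield L))ˣ) :
    quatModule L Ha (baseScalar L Ha y) = IdeleClassGroup.ideleNorm ↥(maximalRealSubfield L) y ^ 4 := by
  rw [quatModule_eq_ideleNorm_quatAdelicNrd, quatAdelicNrd_baseScalar, map_pow, Literature.NumberTheory.AdelicBaseChange.ideleNorm_ideleBaseChange,
    Algebra.IsQuadraticExtension.finrank_eq_two, ← pow_mul]

/-! ## §3 The central section `θ` of the module, surjectivity, and the retraction onto `D^{(1)}_{h,𝔸}` -/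

omit [IsCMField L] in
/-- `4d ≠ 0` for `d = [L⁺ : ℚ]`. [folklore] -/
theorem four_mul_finrank_ne_zero : 4 * Module.finrank ℚ ↥(maximalRealSubfield L) ≠ 0 :=
  Nat.mul_ne_zero (by norm_num) (Module.finrank_pos.ne')

/-- **The central section `θ = quatModuleSection L h : ℝ_{>0} →* (D_h ⊗ 𝔸)^×`**, `t ↦ con(ρ_{L⁺}(t^{1∕4d})) · 1₂` (`d = [L⁺ : ℚ]`, `ρ` = ★ `posRealIdele`, the
diagonal positive-real idèle of `L⁺`; the `4d`-th root via Mathlib `NNReal.rpowMonoidHom`).  The split component `A_G` of the adelic quaternion units, as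
in Weil ∕ Borel for `GL_n`; `quatModule (θ t) = t`. [cite: WeilBNT1967, Ch. IV §4 Cor. 2 of Thm. 5] [cite: Borel1963, §5] [cite: VignerasLNM800, Ch. III §2 (proof of Thm. 2.2)] -/
def quatModuleSection : ℝ≥0ˣ →* ↥(quatAdelicUnits L Ha) :=
  (baseScalar L Ha).comp ((posRealIdele ↥(maximalRealSubfield L)).comp
    (Units.map (NNReal.rpowMonoidHom ((4 * Module.finrank ℚ ↥(maximalRealSubfield L) : ℕ) : ℝ)⁻¹)))

/-- Unfolding of `θ`. [folklore] -/
theorem quatModuleSection_apply (t : ℝ≥0ˣ) :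
    quatModuleSection L Ha t = baseScalar L Ha (posRealIdele ↥(maximalRealSubfield L)
      (Units.map (NNReal.rpowMonoidHom ((4 * Module.finrank ℚ ↥(maximalRealSubfield L) : ℕ) : ℝ)⁻¹) t)) := rfl

/-- The `4d`-th root on `ℝ_{>0}`, unfolded. [folklore] -/
theorem coe_unitsMap_rpowMonoidHom (r : ℝ) (t : ℝ≥0ˣ) :
    ((Units.map (NNReal.rpowMonoidHom r) t : ℝ≥0ˣ) : ℝ≥0) = (t : ℝ≥0) ^ r := rfl

/-- **`quatModuleUnits (θ t) = t`**: `θ` is a section of the units-valued module (`‖ρ(r)‖_{L⁺} = r^d`, ★ `ideleNormUnits_posRealIdele`; `(t^{1∕4d})^{4d} = t`).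
[cite: WeilBNT1967, Ch. IV §4 Cor. 2 of Thm. 5] -/
theorem quatModuleUnits_quatModuleSection (t : ℝ≥0ˣ) : quatModuleUnits L Ha (quatModuleSection L Ha t) = t := by
  apply Units.ext
  rw [coe_quatModuleUnits, quatModuleSection_apply, quatModule_baseScalar, ← coe_ideleNormUnits,
    IdeleClassGroup.ideleNormUnits_posRealIdele, Units.val_pow_eq_pow_val, coe_unitsMap_rpowMonoidHom, ← pow_mul,
    mul_comm (Module.finrank ℚ ↥(maximalRealSubfield L)) 4]
  exact NNReal.rpow_inv_natCast_pow _ (four_mul_finrank_ne_zero L)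

/-- **`quatModule (θ t) = t`** (the `ℝ≥0`-valued form). [cite: WeilBNT1967, Ch. IV §4 Cor. 2 of Thm. 5] -/
theorem quatModule_quatModuleSection (t : ℝ≥0ˣ) : quatModule L Ha (quatModuleSection L Ha t) = (t : ℝ≥0) := by
  rw [← coe_quatModuleUnits, quatModuleUnits_quatModuleSection]

/-- `θ` is continuous (★ `continuous_posRealIdele`, `continuous_baseScalar`, Mathlib `NNReal.continuous_rpow_const`). [folklore] -/
theorem continuous_quatModuleSection : Continuous (quatModuleSection L Ha) := by
  have hroot : Continuous (Units.map (NNReal.rpowMonoidHom ((4 * Module.finrank ℚ ↥(maximalRealSubfield L) : ℕ) : ℝ)⁻¹)) :=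
    Continuous.units_map _ (NNReal.continuous_rpow_const (by positivity))
  exact (continuous_baseScalar L Ha).comp ((continuous_posRealIdele ↥(maximalRealSubfield L)).comp hroot)

/-- `θ(t)` is CENTRAL. [cite: VignerasLNM800, Ch. III §1] -/
theorem quatModuleSection_mul_comm (t : ℝ≥0ˣ) (x : ↥(quatAdelicUnits L Ha)) :
    quatModuleSection L Ha t * x = x * quatModuleSection L Ha t :=
  baseScalar_mul_comm L Ha _ x

/-- `θ` is a right inverse of `quatModuleUnits`. [folklore] -/
theorem rightInverse_quatModuleSection : Function.RightInverse (quatModuleSection L Ha) (quatModuleUnits L Ha) :=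
  quatModuleUnits_quatModuleSection L Ha

/-- **The module is ONTO `ℝ_{>0}`.** [cite: WeilBNT1967, Ch. IV §4 Cor. 3 of Thm. 6] [cite: VignerasLNM800, Ch. III §1] -/
theorem quatModuleUnits_surjective : Function.Surjective (quatModuleUnits L Ha) :=
  (rightInverse_quatModuleSection L Ha).surjective

/-- Every `t > 0` is a module: `∃ x ∈ (D_h ⊗ 𝔸)^×, quatModule x = t`. [cite: VignerasLNM800, Ch. III §1] -/
theorem exists_quatModule_eq (t : ℝ≥0ˣ) : ∃ x : ↥(quatAdelicUnits L Ha), quatModule L Ha x = (t : ℝ≥0) :=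
  ⟨quatModuleSection L Ha t, quatModule_quatModuleSection L Ha t⟩

/-- **The retraction onto `D^{(1)}_{h,𝔸}`**: `x · θ(‖x‖)⁻¹ ∈ D^{(1)}_{h,𝔸}` — the splitting `(D_h ⊗ 𝔸)^× = D^{(1)}_{h,𝔸} · θ(ℝ_{>0})` (product with a central factor).
[cite: VignerasLNM800, Ch. III §2 (proof of Thm. 2.2)] [cite: WeilBNT1967, Ch. IV §4] -/
theorem mul_quatModuleSection_inv_mem_quatAdelicUnitsOne (x : ↥(quatAdelicUnits L Ha)) :
    x * (quatModuleSection L Ha (quatModuleUnits L Ha x))⁻¹ ∈ quatAdelicUnitsOne L Ha := by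
  rw [quatAdelicUnitsOne_eq_ker_quatModuleUnits, MonoidHom.mem_ker, map_mul, map_inv, quatModuleUnits_quatModuleSection, mul_inv_cancel]

/-- Conversely every `x` is `x₁ · θ(t)` with `x₁ ∈ D^{(1)}_{h,𝔸}` and `t = ‖x‖`. [cite: VignerasLNM800, Ch. III §2 (proof of Thm. 2.2)] -/
theorem exists_mem_quatAdelicUnitsOne_mul_quatModuleSection (x : ↥(quatAdelicUnits L Ha)) :
    ∃ x₁ ∈ quatAdelicUnitsOne L Ha, x = x₁ * quatModuleSection L Ha (quatModuleUnits L Ha x) :=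
  ⟨x * (quatModuleSection L Ha (quatModuleUnits L Ha x))⁻¹, mul_quatModuleSection_inv_mem_quatAdelicUnitsOne L Ha x,
    (inv_mul_cancel_right x _).symm⟩

/-- `θ(t) ∈ D^{(1)}_{h,𝔸}` only for `t = 1`: the section meets the module-one group trivially. [cite: WeilBNT1967, Ch. IV §4] -/
theorem quatModuleSection_mem_quatAdelicUnitsOne_iff (t : ℝ≥0ˣ) :
    quatModuleSection L Ha t ∈ quatAdelicUnitsOne L Ha ↔ t = 1 := by
  rw [quatAdelicUnitsOne_eq_ker_quatModuleUnits, MonoidHom.mem_ker, quatModuleUnits_quatModuleSection]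

end Summit.HodgeConjecture.HodgeConjecture.Cruxes.H413.K2E5QuatAdelicModuleOne

end
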